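import Mathlib
import Summits.BirchSwinnertonDyer.BirchSwinnertonDyer.Theorems.ResidualThetaTransportAtTwoSignedMuSeedAtTwoPlusNonsquareDescentSquareClasses
import HarnessLib

/-!
# Non-square descent — SQUARE CLASSES OF UNITS: `𝓔(M_n)/2 ↪ 𝓔(M_{n+1})/2` AT THE LEVEL OF UNIT GROUPS (integrally closed bookkeeping for input (a) of stub S3,
# «the unit/valuation dictionary») — seed crux `SignedMuSeedAtTwoPlus` stmt-BirchSwinnertonDyer-21438 (parent Kμ⁺ `SignedMuVanishingAtTwoPlus`
# stmt-BirchSwinnertonDyer-20689, route ResidualThetaTransportAtTwo), line card `Cruxes/SignedMuSeedAtTwoPlus/Lines/nonsquare-descent.md`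

Cell `bsd-wall`, width seat `bsd-wall-rtt-p4-w2` g18 (`--supports`, closes nothing).  THEOREMS ONLY; BSD is not proved by this and
nothing arithmetic is asserted: integrally-closed-domain algebra.

g17's `isSquare_of_isSquare_algebraMap_of_odd_valuation` (`Theorems/…NonsquareDescentSquareClasses.lean`) is the FIELD-level statement «an
even-valuation `x ∈ F` that becomes a square in the Kummer step `F' = F(√α)`, `v(α)` odd, is a square in `F`».  Stub S3 (a) needs it for UNIT
GROUPS: «`𝓔(M_n)/2 ↪ 𝓔(M_{n+1})/2`», i.e. a unit of `𝒪_{M_n}` that is a square in `M_{n+1}` is the square of a UNIT of `𝒪_{M_n}`.  The missing step is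
integral closedness: if `y² = u` with `u ∈ Aˣ`, `y ∈ Frac A`, then `y ∈ A` (integrally closed) and `y ∈ Aˣ`.  (GNS(m) = «`η_m^{2−σ−σ²}` is not a
square of a UNIT» and «not a square in the FIELD» are thereby the same, and the tower injectivity holds for unit square classes.)

* §1 `exists_unit_sq_eq_of_sq_eq_algebraMap`, `isSquare_units_of_isSquare_algebraMap` — `A` integrally closed in `K = Frac A`: a unit that is a
  square in `K` is a square in `Aˣ`; `isSquare_units_iff_isSquare_algebraMap`.
* §2 **`isSquare_units_of_isSquare_kummer_of_odd_valuation`** — composed with g17: `u ∈ Aˣ` with `v(u) = 1` (trivial valuation on units), a square in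
  the quadratic `F'/F` (`F = Frac A`, `F' = F(√α)`, `v(α)` odd, `2 ≠ 0`) ⟹ `u` is a square in `Aˣ`; contrapositive `not_isSquare_kummer_of_not_isSquare_units`
  («a unit non-square stays a non-square up the tower»).

[folklore]
-/

set_option autoImplicit false
-- the Theorems namespace of this sub repeats the summit name by design (D-0017 nested layout)
set_option linter.dupNamespace false

namespace Summit.BirchSwinnertonDyer.BirchSwinnertonDyer.Theorems.SignedMuAtTwo.NonsquareDescent

/-! ## §1 A unit that is a square in the fraction field is a square of a unit -/

section Units

variable {A : Type*} [CommRing A] [IsIntegrallyClosed A] {K : Type*} [Field K] [Algebra A K] [IsFractionRing A K]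

/-- **`y² = u` in `K = Frac A` with `u ∈ Aˣ`, `A` integrally closed ⟹ `u = w²` for a unit `w ∈ Aˣ`** (`y` is integral — `y² ∈ A` — hence in `A`, and divides
the unit `u`). [folklore] -/
theorem exists_unit_sq_eq_of_sq_eq_algebraMap (u : Aˣ) {y : K} (hy : y ^ 2 = algebraMap A K u) :
    ∃ w : Aˣ, w ^ 2 = u := by
  have hint : IsIntegral A y := by
    refine IsIntegral.of_pow two_pos ?_
    rw [hy]
    exact isIntegral_algebraMap
  obtain ⟨a, ha⟩ := IsIntegrallyClosed.isIntegral_iff.mp hint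
  have ha2 : a ^ 2 = (u : A) := by
    apply (IsFractionRing.injective A K)
    rw [map_pow, ha, hy]
  have hau : IsUnit a := by
    refine IsUnit.of_mul_eq_one (a * ↑u⁻¹) ?_
    rw [← mul_assoc, ← sq, ha2, Units.mul_inv]
  refine ⟨hau.unit, Units.ext ?_⟩
  rw [Units.val_pow_eq_pow_val, IsUnit.unit_spec, ha2]

/-- Square-class form: `IsSquare (algebraMap A K u)` in `K` ⟹ `IsSquare u` in `Aˣ`. [folklore] -/
theorem isSquare_units_of_isSquare_algebraMap (u : Aˣ) (h : IsSquare (algebraMap A K u)) : IsSquare u := by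
  obtain ⟨y, hy⟩ := h
  obtain ⟨w, hw⟩ := exists_unit_sq_eq_of_sq_eq_algebraMap u (y := y) (by rw [sq, ← hy])
  exact ⟨w, by rw [← sq, hw]⟩

/-- Converse (trivial direction) and the equivalence: a unit is a square in `Aˣ` iff it is a square in `Frac A`. [folklore] -/
theorem isSquare_units_iff_isSquare_algebraMap (u : Aˣ) : IsSquare u ↔ IsSquare (algebraMap A K u) := by
  refine ⟨fun ⟨w, hw⟩ => ⟨algebraMap A K w, ?_⟩, isSquare_units_of_isSquare_algebraMap u⟩
  rw [hw, Units.val_mul, map_mul]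

end Units

/-! ## §2 Composition with the field-level Kummer step -/

section Kummer

variable {A : Type*} [CommRing A] [IsIntegrallyClosed A]
  {F : Type*} [Field F] [Algebra A F] [IsFractionRing A F] {F' : Type*} [Field F'] [Algebra F F']

/-- **`𝓔(M_n)/2 ↪ 𝓔(M_{n+1})/2` on unit groups.**  `A` integrally closed with fraction field `F`, `F'/F` quadratic generated by `s`, `s² = α`,
`v` a `ℤ`-valued valuation of `F` with `v(α)` of odd exponent and `v(u) = 1` on the unit `u ∈ Aˣ` (valuations are trivial on units), `2 ≠ 0`: if `u`
becomes a square in `F'` then `u` is the square of a unit of `A`. [folklore] -/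
theorem isSquare_units_of_isSquare_kummer_of_odd_valuation [NeZero (2 : F)] (h2 : Module.finrank F F' = 2)
    (v : Valuation F (WithZero (Multiplicative ℤ))) {α : F} {kα : ℤ}
    (hα : v α = ((Multiplicative.ofAdd kα : Multiplicative ℤ) : WithZero (Multiplicative ℤ))) (hkα : Odd kα)
    {s : F'} (hs : s ^ 2 = algebraMap F F' α) (u : Aˣ) (hvu : v (algebraMap A F u) = 1)
    (hsq : IsSquare (algebraMap F F' (algebraMap A F u))) : IsSquare u := by
  have hx : v (algebraMap A F u) = ((Multiplicative.ofAdd (0 : ℤ) : Multiplicative ℤ) : WithZero (Multiplicative ℤ)) := by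
    rw [hvu, ofAdd_zero, WithZero.coe_one]
  exact isSquare_units_of_isSquare_algebraMap u
    (isSquare_of_isSquare_algebraMap_of_odd_valuation h2 v hα hkα hs hx ⟨0, rfl⟩ hsq)

/-- Contrapositive: **a unit that is not a square of a unit stays a non-square in the Kummer step** («GNS(m) persists up the tower», unit form
of g17's `not_isSquare_algebraMap_of_not_isSquare`). [folklore] -/
theorem not_isSquare_kummer_of_not_isSquare_units [NeZero (2 : F)] (h2 : Module.finrank F F' = 2)
    (v : Valuation F (WithZero (Multiplicative ℤ))) {α : F} {kα : ℤ}
    (hα : v α = ((Multiplicative.ofAdd kα : Multiplicative ℤ) : WithZero (Multiplicative ℤ))) (hkα : Odd kα)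
    {s : F'} (hs : s ^ 2 = algebraMap F F' α) (u : Aˣ) (hvu : v (algebraMap A F u) = 1)
    (hnsq : ¬ IsSquare u) : ¬ IsSquare (algebraMap F F' (algebraMap A F u)) :=
  fun hsq => hnsq (isSquare_units_of_isSquare_kummer_of_odd_valuation h2 v hα hkα hs u hvu hsq)

end Kummer

end Summit.BirchSwinnertonDyer.BirchSwinnertonDyer.Theorems.SignedMuAtTwo.NonsquareDescent
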